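import Summits.HodgeConjecture.CorCM.Census.FaceSquaresModel

/-!
# Face classes modulo divisor pairs: generation certificates and separating functionals (generic kernel engine, sequel)

COR-CM (cell `pub-hodgecm2`), count-neutral kernel census by seat b30 (gen 17, claim OCTIC-FACE-CENSUS), sequel of
`Census/FaceSquaresModel.lean` (same conventions: Cayley table on `Fin n`, types/labels = bitmasks, faces = triples of masks).
Definitions only (closed `Bool` checkers); nothing is asserted here.

WHAT IS CHECKED [folklore dictionary; [cite: Pohlmann1968, Thm 1]].  In the label encoding of `FaceSquaresModel` the exponent vector
of the `1`-eigencomponent of the face Weil line of `f` is the indicator of its CORNER SET, and the other eigencomponents / the Galois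
conjugates are the corner sets of the twisted faces; a divisor (conjugate) pair is the indicator of `{L, L̄}`.  The tree's Lefschetz
character `lefChar f.corner (fun _ ↦ {σ₀})` (`CorCM/CM/LefschetzChar1.lean`: `Σ_j achar (pullType Φ_j σ₀)` in
`Asym F = ℤ[CM types]/(Ψ + Ψ̄)`) is exactly this corner-set indicator READ MODULO PAIRS.  Hence, for a set `𝒮` of orbit representatives:
* `generationCertOK 𝒮 certs` checks, for EVERY face `f`, an explicit identity
  `1_{corners f} = Σ_i c_i · 1_{corners g_i} + Σ_j d_j · 1_{{P_j, P̄_j}}` over `ℤ` with every `g_i` a face whose type square is a Galois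
  twist of the square of a member of `𝒮` — i.e. the face characters of the `𝒮`-orbits GENERATE all face characters modulo pairs
  (the hypothesis `hgen` of b23's `CorCM/FacePeriodsGeneratingSet.lean` in the finite model, with `𝒮` replaced by the union of its
  orbits; by b06's `Model.periodNV_orbit` one period per orbit feeds the whole orbit);
* `separatesOK p φ 𝒮 w` checks a functional `φ : labels → ℤ` that vanishes modulo `p` (`p = 0`: exactly) on every pair and on the
  corner set of every face of the `𝒮`-orbits but NOT on the corner set of the witness face `w` — so the `𝒮`-orbits do NOT generate
  modulo pairs (minimality certificates).
-/

namespace Summit.HodgeConjecture.CorCM.Census.FaceSquaresModel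

namespace CMGaloisType

variable {n : ℕ} (Γ : CMGaloisType n)

/-- The generator faces allowed for the orbit set `𝒮`: faces whose type square is a twist of the square of a member of `𝒮`. [folklore] -/
def inOrbits (𝒮 : List (ℕ × ℕ × ℕ)) (g : ℕ × ℕ × ℕ) : Bool :=
  Γ.faces.contains g && 𝒮.any fun r => Γ.isTwistOf (square r) (square g)

/-- Value at the label `L` of `Σ_i c_i · 1_{corners g_i} + Σ_j d_j · 1_{{P_j, P̄_j}}`. [folklore] -/
def comboVal (fc : List ((ℕ × ℕ × ℕ) × ℤ)) (pc : List (ℕ × ℤ)) (L : ℕ) : ℤ :=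
  (fc.map fun gi => if (Γ.corners gi.1).contains L then gi.2 else 0).sum +
    (pc.map fun pj => (if L == pj.1 then pj.2 else 0) + (if L == Γ.bar pj.1 then pj.2 else 0)).sum

/-- One certificate: all generator faces allowed, and `1_{corners f} = combo` at every CM-type label. [folklore] -/
def certOK (𝒮 : List (ℕ × ℕ × ℕ)) (f : ℕ × ℕ × ℕ) (fc : List ((ℕ × ℕ × ℕ) × ℤ)) (pc : List (ℕ × ℤ)) : Bool :=
  (fc.all fun gi => Γ.inOrbits 𝒮 gi.1) &&
    Γ.cmTypes.all fun L => (if (Γ.corners f).contains L then (1 : ℤ) else 0) == Γ.comboVal fc pc L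

/-- **Generation certificate**: every face of `(G, c)` has a certificate over the `𝒮`-orbits. [folklore] -/
def generationCertOK (𝒮 : List (ℕ × ℕ × ℕ)) (certs : List ((ℕ × ℕ × ℕ) × List ((ℕ × ℕ × ℕ) × ℤ) × List (ℕ × ℤ))) : Bool :=
  Γ.faces.all fun f => certs.any fun c => c.1 == f && Γ.certOK 𝒮 f c.2.1 c.2.2

/-- Value of the functional `φ` (list of (label, coefficient)) on the indicator of a label list. [folklore] -/
def phiVal (φ : List (ℕ × ℤ)) (S : List ℕ) : ℤ := (S.map fun L => ((φ.filter fun q => q.1 == L).map fun q => q.2).sum).sum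

/-- `x ≡ 0 (mod p)`, with `p = 0` meaning `x = 0` (`Int.emod x 0 = x`). [folklore] -/
def dvdZ (p : ℕ) (x : ℤ) : Bool := x % (p : ℤ) == 0

/-- **Separating functional**: `φ` vanishes mod `p` on all divisor pairs and on the corner sets of all faces of the `𝒮`-orbits, but not
on the corner set of the witness face `w` — the `𝒮`-orbits do not generate the face characters modulo pairs. [folklore] -/
def separatesOK (p : ℕ) (φ : List (ℕ × ℤ)) (𝒮 : List (ℕ × ℕ × ℕ)) (w : ℕ × ℕ × ℕ) : Bool :=
  (Γ.cmTypes.all fun L => dvdZ p (phiVal φ [L, Γ.bar L])) &&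
    (Γ.faces.all fun g => !Γ.inOrbits 𝒮 g || dvdZ p (phiVal φ (Γ.corners g))) &&
    Γ.faces.contains w && !dvdZ p (phiVal φ (Γ.corners w))

end CMGaloisType

end Summit.HodgeConjecture.CorCM.Census.FaceSquaresModel
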